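import Summits.HodgeConjecture.HodgeConjecture.Theorems.Ring2AbelianAllAndrePolarPairsTop
import Summits.HodgeConjecture.HodgeConjecture.Theorems.Ring2AbelianAllAndrePolarClassInverse
import Summits.HodgeConjecture.HodgeConjecture.Theorems.Ring2AbelianAllAndreLiebermanCorrespondenceAlgebra
import HarnessLib

/-!
# Ring 2 · sub-cell AbelianAll (ALL ABELIAN VARIETIES), André axis, part XXXVIII-e₂ — THE KLEIMAN IDENTITY OF THE BLOCK `b = 1` ON A
# POLARISED ABELIAN VARIETY: `[ℓ(θ)²]_*(x ∪ θ^{g-2}) + (2/(g-1)) · θ ∪ [1]_*(x ∪ θ^{g-1}) = c₀ · x` on `H²(A(ℂ); ℂ)`, `c₀ ≠ 0`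
# — the square of the Poincaré class, twisted by `θ`, inverts `L^{g-2}` on `H²` up to the trace term

HONEST FRAMING (page 1, verbatim): **research route, not a corollary; conditional on HC_CM plus one named
minimal statement.** Cell line: research route conditional on HC_CM; not a corollary; Q11.4-sentence-2
already refuted in dim ≥ 3. Nothing in this file proves a case of the Hodge conjecture; `HC_CM` does not occur.

Gen-30 file of the `ab-andre-2` seat (cell `pub-hodge-ring2`, sub-cell AbelianAll = ALL abelian varieties, not Weil-type-only).

## What this file proves (sorry-free, standard axioms only)

For a complex abelian variety `A` of dimension `g = r + 3`, a rational class `θ` with `θ ⊗ 1` a polarisation, the complexified Poincaré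
class `ℓ = ℓ(θ) ⊗ 1` (`ℓ(θ) = m^*θ − pr₁^*θ − pr₂^*θ`) and `Θ = θ ⊗ 1`:
**`exists_kleimanCoefficients_blockOne`** — there are `c : Fin 2 → ℂ` and `c₀ ≠ 0` with, for every `x ∈ H²(A(ℂ); ℂ)`,
`c₀ · Θ⁰ ∪ [ℓ²]_*((x ∪ Θ^{r+1}) ∪ Θ⁰) + c₁ · Θ¹ ∪ [ℓ⁰]_*((x ∪ Θ^{r+1}) ∪ Θ¹) = c₀ · x` — EXACTLY the hypothesis `hAid` of part
XXXVIII-d's `exists_kleimanCoefficients_of_poincareSquareClass` for the block `(b, r) = (1, r)` with exponents `i = ![2, 0]`, `j = ![0, 1]`.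
Proof: `ℓ² = −Σ_{a,c} pr₁^*(b_a b_c) ∪ pr₂^*(y_a y_c)` (polar family `y` of `θ` along a basis `b` of `H¹(A(ℂ); ℚ)`); the action of a cross
product is `τ(c ∪ y) · x` (part XXII-a); the traced double sum of part XXXVIII-e₁ gives
`[ℓ²]_*(x ∪ Θ^{r+1}) = (2κ tr θ^g/((r+2)(r+3))) x − (2κ/(r+2)) tr(x₀ θ^{g-1}) Θ` on rational `x = x₀ ⊗ 1`, and
`Θ ∪ [1]_*((x ∪ Θ^{r+1}) ∪ Θ) = κ tr(x₀ θ^{g-1}) Θ`; take `c = (1, 2/(r+2))`; extend by linearity (rational classes span).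
Helper lemmas: `cupPow_one_eq`, `cupPow_two_eq`, `polClass_sq_eq_neg_sum` (rational), `cup_cupPow_cup_cup_eq` (reassociation),
`corrAction_cupProduct_one` (`[γ]_*(Z ∪ 1) = [γ]_* Z` across degree spellings).

## Documentary interface

PRINT: Kleiman, Dix exposés, App. to §2, 2A8–2A11 (`θ`, `Λ` on an abelian variety are polynomials in `L` and the `ℓⁱ`); Lieberman,
Amer. J. Math. 90 (1968); Beauville, LNM 1016 (1983), §3; [Kunnemann1993, Thm. 3.1]; [MumfordAV1970, §§1, 16, 20]. LEAN: displayed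
theorems, fact-free; inputs COR-CM's model layer (`exists_polClass_eq_sum`, `smul_cup_polar_cup_cupPow`, `sum_cup_polarFamily_eq_two_smul`),
parts XXII-a (`exists_crossFunctional`, `exists_eq_mul_tr`) and XXXVIII-e₁ (`sum_sum_smul_cup_eq`).
-/

noncomputable section

set_option linter.dupNamespace false

namespace Summit.HodgeConjecture.HodgeConjecture.Ring2.AbelianAll

open CategoryTheory AlgebraicGeometry MonoidalCategory CartesianMonoidalCategory
open Literature.AlgebraicGeometry Literature.AlgebraicGeometry.Motives
open Literature.AlgebraicGeometry.HodgeTheory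
open Literature.AlgebraicTopology.SingularHomology (singularCohomology cupProduct cupProduct_map cupProduct_assoc
  cupProduct_gradedComm_holds cupProduct_one one_cupProduct)
open Literature.AlgebraicTopology.CharacteristicClasses (cupPow cupPow_zero cupPow_succ)
open Literature.NumberTheory.Automorphic.PicardCM (ratAlgebraicClasses mem_ratAlgebraicClasses_iff)
open Summit.HodgeConjecture.CorCM.Model
open scoped MonObj

/-! ## §1 Helper lemmas -/

section Helpers

variable {Y : Type} [TopologicalSpace Y]

/-- `x¹ = x` for a degree-two class. [cite: HatcherAT2002, §3.2] -/
theorem cupPow_one_eq (x : singularCohomology ℂ ℂ Y 2) : cupPow ℂ x 1 = x := by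
  rw [cupPow_succ, cupPow_zero]; exact one_cupProduct x

/-- `x² = x ∪ x` for a degree-two class. [cite: HatcherAT2002, §3.2] -/
theorem cupPow_two_eq (x : singularCohomology ℂ ℂ Y 2) : cupPow ℂ x 2 = cupProduct (show 2 * 1 + 2 = 2 * (1 + 1) by norm_num) x x := by
  rw [cupPow_succ, cupPow_one_eq]

end Helpers

section Rational

variable (A : AbelianVariety ℂ)

/-- **`ℓ(θ)² = −Σ_{a,c} pr₁^*(b_a ∪ b_c) ∪ pr₂^*(y_a ∪ y_c)`** on the rational carriers of `A × A`, for the polar family `y` of `θ` along a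
basis `b` (`ℓ(θ) = Σ_a pr₁^*b_a ∪ pr₂^*y_a`; the interchange law `(α ∪ β) ∪ (γ ∪ δ) = −(α ∪ γ) ∪ (β ∪ δ)` in degree one).
[cite: MumfordAV1970, §1 (4)] [cite: HatcherAT2002, §3.2 Thm. 3.11] -/
theorem polClass_sq_eq_neg_sum {n : ℕ} (b : Module.Basis (Fin n) ℚ (bettiCohomology A.X 1))
    {θ : bettiCohomology A.X 2} {y : Fin n → bettiCohomology A.X 1}
    (hℓ : BettiUniverse.pull μ[A.X] 2 θ - BettiUniverse.pull (fst A.X A.X) 2 θ - BettiUniverse.pull (snd A.X A.X) 2 θ =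
      ∑ a, BettiUniverse.cup (A.X ⊗ A.X) 1 1 (BettiUniverse.pull (fst A.X A.X) 1 (b a))
        (BettiUniverse.pull (snd A.X A.X) 1 (y a))) :
    BettiUniverse.cup (A.X ⊗ A.X) 2 2
        (BettiUniverse.pull μ[A.X] 2 θ - BettiUniverse.pull (fst A.X A.X) 2 θ - BettiUniverse.pull (snd A.X A.X) 2 θ)
        (BettiUniverse.pull μ[A.X] 2 θ - BettiUniverse.pull (fst A.X A.X) 2 θ - BettiUniverse.pull (snd A.X A.X) 2 θ) =
      -∑ a, ∑ c, BettiUniverse.cup (A.X ⊗ A.X) 2 2 (BettiUniverse.pull (fst A.X A.X) (1 + 1) (BettiUniverse.cup A.X 1 1 (b a) (b c)))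
        (BettiUniverse.pull (snd A.X A.X) (1 + 1) (BettiUniverse.cup A.X 1 1 (y a) (y c))) := by
  rw [hℓ, LinearMap.map_sum₂, ← Finset.sum_neg_distrib]
  refine Finset.sum_congr rfl fun a _ ↦ ?_
  rw [map_sum, ← Finset.sum_neg_distrib]
  refine Finset.sum_congr rfl fun c _ ↦ ?_
  rw [BettiUniverse.cup_interchange_one, ← BettiUniverse.pull_cup, ← BettiUniverse.pull_cup]

/-- **Reassociation `(x ∪ θ^{r+1}) ∪ (u ∪ v) = x ∪ (u ∪ (v ∪ θ^{r+1}))`** (rational carriers; `θ^{r+1}` has even degree), landing in the degree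
spelling of part XXXVIII-e₁. [cite: HatcherAT2002, §3.2 Thm. 3.11] -/
theorem cup_cupPow_cup_cup_eq {r : ℕ} (x : bettiCohomology A.X 2) (u v : bettiCohomology A.X 1) (P : bettiCohomology A.X (2 * (r + 1)))
    (h : 1 + 1 + 2 * (r + 1) + (1 + 1) = 2 * (r + 2 + 1)) :
    cupProduct h (cupProduct (rfl : 1 + 1 + 2 * (r + 1) = 1 + 1 + 2 * (r + 1)) x P) (cupProduct (rfl : 1 + 1 = 1 + 1) u v) =
      cupProduct (show 2 + (2 * (r + 1) + 1 + 1) = 2 * (r + 1) + 1 + 1 + 1 + 1 by omega) x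
        (cupProduct (Nat.add_comm 1 (2 * (r + 1) + 1)) u (cupProduct (show 1 + 2 * (r + 1) = 2 * (r + 1) + 1 by omega) v P)) := by
  rw [cupProduct_assoc (rfl : 1 + 1 + 2 * (r + 1) = 1 + 1 + 2 * (r + 1)) (show 2 * (r + 1) + (1 + 1) = 2 * (r + 1) + 1 + 1 by omega) h
      (show 1 + 1 + (2 * (r + 1) + 1 + 1) = 2 * (r + 2 + 1) by omega) x P (cupProduct (rfl : 1 + 1 = 1 + 1) u v),
    cupProduct_gradedComm_holds ℚ (ComplexPoints A.X) (show 2 * (r + 1) + (1 + 1) = 2 * (r + 1) + 1 + 1 by omega)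
      (show 1 + 1 + 2 * (r + 1) = 2 * (r + 1) + 1 + 1 by omega) P (cupProduct (rfl : 1 + 1 = 1 + 1) u v),
    show ((-1 : ℚ) ^ (2 * (r + 1) * (1 + 1))) = 1 from Even.neg_one_pow ⟨2 * (r + 1), by ring⟩, one_smul,
    cupProduct_assoc (rfl : 1 + 1 = 1 + 1) (show 1 + 2 * (r + 1) = 2 * (r + 1) + 1 by omega)
      (show 1 + 1 + 2 * (r + 1) = 2 * (r + 1) + 1 + 1 by omega) (Nat.add_comm 1 (2 * (r + 1) + 1)) u v P]

end Rational

section Complex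

variable {X : SchemeOver ℂ} {n : ℕ}

/-- **`[γ]_*(Z ∪ 1) = [γ]_* Z`** across degree spellings (`pr₂^*(Z ∪ 1) ∪ γ = pr₂^* Z ∪ (1 ∪ γ) = pr₂^* Z ∪ γ`). [cite: HatcherAT2002, §3.2] -/
theorem corrAction_cupProduct_one (μ' : OrientationFamily) (hX : IsSmoothProjective n X) {e a a' b' : ℕ} (h : a' + 0 = a)
    (hab : a + 2 * e = b' + 2 * n) (hab' : a' + 2 * e = b' + 2 * n) (cl : complexBetti (X ⊗ X) (2 * e)) (Z : complexBetti X a') :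
    corrAction μ' hX hX hab cl (cupProduct h Z (singularCohomology.one ℂ (ComplexPoints X))) = corrAction μ' hX hX hab' cl Z := by
  have hXX := IsSmoothProjective.tensor_holds hX hX
  rw [corrAction_apply, corrAction_apply, complexBetti.map_cupProduct,
    show complexBetti.map (snd X X) 0 (singularCohomology.one ℂ (ComplexPoints X)) = singularCohomology.one ℂ (ComplexPoints (X ⊗ X))
      from singularCohomology.map_one _,
    cupProduct_assoc h (Nat.zero_add (2 * e)) (rfl : a + 2 * e = a + 2 * e) (show a' + 2 * e = a + 2 * e by omega)
      (complexBetti.map (snd X X) a' Z) (singularCohomology.one ℂ (ComplexPoints (X ⊗ X))) cl, one_cupProduct]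
  exact complexGysin_cupProduct_congr μ' hXX hX (fst X X) _ _ _ _ _ _

end Complex

/-! ## §2 The Kleiman identity of the block `b = 1` -/

section BlockOne

variable (A : AbelianVariety ℂ)

/-- The exponents of the block `b = 1`: `i = (2, 0)`, `j = (0, 1)`, `i_l + 2 j_l = 2`. [folklore] -/
theorem kleimanExponents_blockOne (l : Fin 2) : (![2, 0] : Fin 2 → ℕ) l + 2 * (![0, 1] : Fin 2 → ℕ) l = 1 + 1 := by
  fin_cases l <;> rfl

/-- **THE KLEIMAN IDENTITY OF THE BLOCK `b = 1` ON A POLARISED ABELIAN VARIETY** (module docstring): for `A` of dimension `g = k + 1 = r + 3`,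
a rational `θ` with `θ ⊗ 1` a polarisation class, `ℓ = ℓ(θ) ⊗ 1` and `Θ = θ ⊗ 1`, there are `c : Fin 2 → ℂ` and `c₀ ≠ 0` with
`Σ_l c_l · Θ^{j_l} ∪ [ℓ^{i_l}]_*((x ∪ Θ^{r+1}) ∪ Θ^{j_l}) = c₀ · x` on `H²(A(ℂ); ℂ)`, `i = (2, 0)`, `j = (0, 1)` — the hypothesis `hAid` of
part XXXVIII-d's `exists_kleimanCoefficients_of_poincareSquareClass` for `b = 1`. Representation-theoretically: `[ℓ²]_* ∘ L^{g-2}` is a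
non-zero multiple of the identity MODULO the trace form `x ↦ ⟨x θ^{g-1}⟩ θ`, which is the correspondence `θ ∪ [1]_* ∘ L^{g-1}`.
[cite: Kleiman1968AlgebraicCycles, App. to §2, Thm. 2A9 and 2A11] [cite: Lieberman1968, main theorem] [cite: MumfordAV1970, §16 and §20] -/
theorem exists_kleimanCoefficients_blockOne {r k : ℕ} (hrk : r + 2 = k) (hA : IsSmoothProjective (k + 1) A.X) (hdim : A.dim = k + 1)
    (θ : bettiCohomology A.X 2) (hθ : IsPolarizationClass (k + 1) A.X (ofRatClass (ComplexPoints A.X) 2 θ)) :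
    ∃ (c : Fin 2 → ℂ) (c₀ : ℂ), c₀ ≠ 0 ∧ ∀ x' : complexBetti A.X (1 + 1),
      ∑ l, c l • cupProduct (show 2 * (![0, 1] : Fin 2 → ℕ) l + (![2, 0] : Fin 2 → ℕ) l = 1 + 1 by
            have := kleimanExponents_blockOne l; omega)
        (cupPow ℂ (ofRatClass (ComplexPoints A.X) 2 θ) ((![0, 1] : Fin 2 → ℕ) l))
        (corrAction complexOrientationFamily hA hA
          (show 1 + 1 + 2 * (r + 1) + 2 * (![0, 1] : Fin 2 → ℕ) l + 2 * (![2, 0] : Fin 2 → ℕ) l =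
            (![2, 0] : Fin 2 → ℕ) l + 2 * (k + 1) by have := kleimanExponents_blockOne l; omega)
          (cupPow ℂ (ofRatClass (ComplexPoints (A.X ⊗ A.X)) 2
            (BettiUniverse.pull μ[A.X] 2 θ - BettiUniverse.pull (fst A.X A.X) 2 θ - BettiUniverse.pull (snd A.X A.X) 2 θ))
            ((![2, 0] : Fin 2 → ℕ) l))
          (cupProduct (rfl : 1 + 1 + 2 * (r + 1) + 2 * (![0, 1] : Fin 2 → ℕ) l = 1 + 1 + 2 * (r + 1) + 2 * (![0, 1] : Fin 2 → ℕ) l)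
            (cupProduct (rfl : 1 + 1 + 2 * (r + 1) = 1 + 1 + 2 * (r + 1)) x'
              (cupPow ℂ (ofRatClass (ComplexPoints A.X) 2 θ) (r + 1)))
            (cupPow ℂ (ofRatClass (ComplexPoints A.X) 2 θ) ((![0, 1] : Fin 2 → ℕ) l)))) = c₀ • x' := by
  classical
  subst hrk
  -- basis, polar family, Poincaré class, cross functional
  haveI : FiniteDimensional ℚ (bettiCohomology A.X 1) := finiteDimensional_bettiCohomology hA 1
  let b : Module.Basis (Fin (Module.finrank ℚ (bettiCohomology A.X 1))) ℚ (bettiCohomology A.X 1) := Module.finBasis ℚ _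
  obtain ⟨y, hℓ⟩ := exists_polClass_eq_sum A b θ
  set Θ : complexBetti A.X 2 := ofRatClass (ComplexPoints A.X) 2 θ with hΘ
  set L : complexBetti (A.X ⊗ A.X) 2 := ofRatClass (ComplexPoints (A.X ⊗ A.X)) 2
    (BettiUniverse.pull μ[A.X] 2 θ - BettiUniverse.pull (fst A.X A.X) 2 θ - BettiUniverse.pull (snd A.X A.X) 2 θ) with hL
  have hΘpow : ∀ m : ℕ, cupPow ℂ Θ m = ofRatClass (ComplexPoints A.X) (2 * m) (cupPow ℚ θ m) := fun m ↦ by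
    rw [hΘ, cupPow_complex_eq_cupPowTwo, ← ofRatClass_cupPow]
  obtain ⟨τ, hτ0, hτ⟩ := exists_crossFunctional hA hA
  obtain ⟨κ, hκ⟩ := exists_eq_mul_tr hA τ
  have hκ0 : κ ≠ 0 := by
    intro hκ0
    have hzero : ∀ w : bettiCohomology A.X (2 * (r + 2 + 1)), ofRatClass (ComplexPoints A.X) (2 * (r + 2 + 1)) w = 0 := fun w ↦
      hτ0 _ (by rw [hκ w, hκ0, zero_mul])
    haveI : FiniteDimensional ℚ (bettiCohomology A.X (2 * (r + 2 + 1))) := finiteDimensional_bettiCohomology hA _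
    have h1 : Module.finrank ℚ (bettiCohomology A.X (2 * (r + 2 + 1))) = 1 := finrank_rat_top hA
    obtain ⟨w, hw⟩ := (Module.finrank_pos_iff_exists_ne_zero (R := ℚ) (M := bettiCohomology A.X (2 * (r + 2 + 1)))).1 (by omega)
    exact hw (ofRatClass_injective (Y := ComplexPoints A.X) _ (by rw [hzero w, map_zero]))
  have hθtop : cupPow ℚ θ (r + 1 + 2) ≠ 0 := cupPow_ne_zero_of_hasHardLefschetz hA θ hθ.hasHardLefschetz
  have htr : (BettiUniverse.tr hA (2 * (r + 2 + 1)) (cupPow ℚ θ (r + 1 + 2)) : ℂ) ≠ 0 := by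
    exact_mod_cast fun h ↦ hθtop (tr_top_injective hA (by rw [h, map_zero]))
  have hk : r + 1 + 2 = A.dim := by omega
  have hr2 : ((r + 2 : ℕ) : ℂ) ≠ 0 := by exact_mod_cast Nat.succ_ne_zero (r + 1)
  have hr3 : ((r + 3 : ℕ) : ℂ) ≠ 0 := by exact_mod_cast Nat.succ_ne_zero (r + 2)
  -- the scalar
  set c₀ : ℂ := 2 * κ * (BettiUniverse.tr hA (2 * (r + 2 + 1)) (cupPow ℚ θ (r + 1 + 2)) : ℂ) / (((r + 2 : ℕ) : ℂ) * ((r + 3 : ℕ) : ℂ))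
    with hc₀
  refine ⟨![1, 2 / ((r + 2 : ℕ) : ℂ)], c₀, ?_, fun x' ↦ ?_⟩
  · rw [hc₀]
    exact div_ne_zero (mul_ne_zero (mul_ne_zero two_ne_zero hκ0) htr) (mul_ne_zero hr2 hr3)
  rw [Fin.sum_univ_two]
  show (1 : ℂ) • cupProduct (show 2 * 0 + 2 = 1 + 1 by norm_num) (cupPow ℂ Θ 0)
      (corrAction complexOrientationFamily hA hA (show 1 + 1 + 2 * (r + 1) + 2 * 0 + 2 * 2 = 2 + 2 * (r + 2 + 1) by omega) (cupPow ℂ L 2)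
        (cupProduct (rfl : 1 + 1 + 2 * (r + 1) + 2 * 0 = 1 + 1 + 2 * (r + 1) + 2 * 0)
          (cupProduct (rfl : 1 + 1 + 2 * (r + 1) = 1 + 1 + 2 * (r + 1)) x' (cupPow ℂ Θ (r + 1))) (cupPow ℂ Θ 0))) +
    (2 / ((r + 2 : ℕ) : ℂ)) • cupProduct (show 2 * 1 + 0 = 1 + 1 by norm_num) (cupPow ℂ Θ 1)
      (corrAction complexOrientationFamily hA hA (show 1 + 1 + 2 * (r + 1) + 2 * 1 + 2 * 0 = 0 + 2 * (r + 2 + 1) by omega)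
        (cupPow ℂ L 0)
        (cupProduct (rfl : 1 + 1 + 2 * (r + 1) + 2 * 1 = 1 + 1 + 2 * (r + 1) + 2 * 1)
          (cupProduct (rfl : 1 + 1 + 2 * (r + 1) = 1 + 1 + 2 * (r + 1)) x' (cupPow ℂ Θ (r + 1))) (cupPow ℂ Θ 1))) = c₀ • x'
  -- normalise the two terms: `Θ⁰ = 1`, `ℓ⁰ = 1`, `Z ∪ 1 = Z`, `1 ∪ V = V`
  rw [one_smul, cupPow_zero, cupPow_zero,
    corrAction_cupProduct_one complexOrientationFamily hA (show 1 + 1 + 2 * (r + 1) + 0 = 1 + 1 + 2 * (r + 1) + 2 * 0 by rfl) _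
      (show 1 + 1 + 2 * (r + 1) + 2 * 2 = 2 + 2 * (r + 2 + 1) by omega),
    show ∀ V : complexBetti A.X 2, cupProduct (show 2 * 0 + 2 = 1 + 1 by norm_num) (singularCohomology.one ℂ (ComplexPoints A.X)) V = V
      from fun V ↦ one_cupProduct V]
  -- (T₀) the square term on rational classes
  have hT₀ : ∀ x₀ : bettiCohomology A.X (1 + 1),
      corrAction complexOrientationFamily hA hA (show 1 + 1 + 2 * (r + 1) + 2 * 2 = 2 + 2 * (r + 2 + 1) by omega) (cupPow ℂ L 2)
        (cupProduct (rfl : 1 + 1 + 2 * (r + 1) = 1 + 1 + 2 * (r + 1)) (ofRatClass (ComplexPoints A.X) (1 + 1) x₀) (cupPow ℂ Θ (r + 1))) =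
        c₀ • ofRatClass (ComplexPoints A.X) (1 + 1) x₀ -
          (2 * κ / ((r + 2 : ℕ) : ℂ) * (BettiUniverse.tr hA (2 * (r + 2 + 1))
            (cupProduct (show 2 + 2 * (r + 1 + 1) = 2 * (r + 1) + 1 + 1 + 1 + 1 by omega) x₀ (cupPow ℚ θ (r + 1 + 1))) : ℂ)) • Θ := by
    intro x₀
    -- `ℓ² = −Σ pr₁^*((b_a b_c) ⊗ 1) ∪ pr₂^*((y_a y_c) ⊗ 1)`
    have hL2 : cupPow ℂ L 2 = -∑ a, ∑ c, cupProduct (rfl : 1 + 1 + (1 + 1) = 1 + 1 + (1 + 1))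
        (complexBetti.map (fst A.X A.X) (1 + 1) (ofRatClass (ComplexPoints A.X) (1 + 1) (BettiUniverse.cup A.X 1 1 (b a) (b c))))
        (complexBetti.map (snd A.X A.X) (1 + 1) (ofRatClass (ComplexPoints A.X) (1 + 1) (BettiUniverse.cup A.X 1 1 (y a) (y c)))) := by
      rw [cupPow_two_eq, hL, show cupProduct (show 2 * 1 + 2 = 2 * (1 + 1) by norm_num)
          (ofRatClass (ComplexPoints (A.X ⊗ A.X)) 2 (BettiUniverse.pull μ[A.X] 2 θ - BettiUniverse.pull (fst A.X A.X) 2 θ -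
            BettiUniverse.pull (snd A.X A.X) 2 θ))
          (ofRatClass (ComplexPoints (A.X ⊗ A.X)) 2 (BettiUniverse.pull μ[A.X] 2 θ - BettiUniverse.pull (fst A.X A.X) 2 θ -
            BettiUniverse.pull (snd A.X A.X) 2 θ)) =
          ofRatClass (ComplexPoints (A.X ⊗ A.X)) (2 + 2) (BettiUniverse.cup (A.X ⊗ A.X) 2 2
            (BettiUniverse.pull μ[A.X] 2 θ - BettiUniverse.pull (fst A.X A.X) 2 θ - BettiUniverse.pull (snd A.X A.X) 2 θ)
            (BettiUniverse.pull μ[A.X] 2 θ - BettiUniverse.pull (fst A.X A.X) 2 θ - BettiUniverse.pull (snd A.X A.X) 2 θ))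
          from (ofRatClass_cupProduct _ _ _).symm, polClass_sq_eq_neg_sum A b hℓ, map_neg, map_sum]
      congr 1
      refine Finset.sum_congr rfl fun a _ ↦ ?_
      rw [map_sum]
      refine Finset.sum_congr rfl fun c _ ↦ ?_
      rw [ofRatClass_cupProduct, ofRatClass_pull, ofRatClass_pull]
    rw [hL2, map_neg, map_sum, LinearMap.neg_apply, LinearMap.sum_apply]
    simp_rw [map_sum, LinearMap.sum_apply]
    have hak : 1 + 1 + 2 * (r + 1) + (1 + 1) = 2 * (r + 2 + 1) := by omega
    simp_rw [hτ (rfl : 1 + 1 + (1 + 1) = 1 + 1 + (1 + 1)) (show 1 + 1 + 2 * (r + 1) + 2 * 2 = 2 + 2 * (r + 2 + 1) by omega) hak,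
      show ((-1 : ℂ) ^ ((1 + 1 + 2 * (r + 1)) * (1 + 1))) = 1 from Even.neg_one_pow ⟨1 + 1 + 2 * (r + 1), by ring⟩, one_mul]
    -- the traces are rational: `τ((x₀ θ^{r+1} ∪ y_a y_c) ⊗ 1) = κ tr(x₀ ∪ (y_a ∪ (y_c ∪ θ^{r+1})))`
    have htrace : ∀ a c, τ (cupProduct hak (cupProduct (rfl : 1 + 1 + 2 * (r + 1) = 1 + 1 + 2 * (r + 1))
        (ofRatClass (ComplexPoints A.X) (1 + 1) x₀) (cupPow ℂ Θ (r + 1)))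
        (ofRatClass (ComplexPoints A.X) (1 + 1) (BettiUniverse.cup A.X 1 1 (y a) (y c)))) =
        κ * (BettiUniverse.tr hA (2 * (r + 2 + 1)) (cupProduct (show 2 + (2 * (r + 1) + 1 + 1) = 2 * (r + 1) + 1 + 1 + 1 + 1 by omega) x₀
          (cupProduct (Nat.add_comm 1 (2 * (r + 1) + 1)) (y a) (cupProduct (show 1 + 2 * (r + 1) = 2 * (r + 1) + 1 by omega) (y c)
            (cupPow ℚ θ (r + 1))))) : ℂ) := by
      intro a c
      rw [hΘpow, ← ofRatClass_cupProduct, ← ofRatClass_cupProduct, hκ, cup_cupPow_cup_cup_eq A x₀ (y a) (y c) (cupPow ℚ θ (r + 1)) hak]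
    simp_rw [htrace]
    -- the traced double sum of part XXXVIII-e₁
    have hsum := sum_sum_smul_cup_eq A hk b hℓ (BettiUniverse.tr hA (2 * (r + 2 + 1))) x₀
    have hC : (((r + 1 + 1) * (r + 1 + 2) : ℕ) : ℂ) = ((r + 2 : ℕ) : ℂ) * ((r + 3 : ℕ) : ℂ) := by push_cast; ring
    -- complexify `hsum`
    have hCneC : (((r + 1 + 1) * (r + 1 + 2) : ℕ) : ℂ) ≠ 0 := by exact_mod_cast (show ((r + 1 + 1) * (r + 1 + 2) : ℕ) ≠ 0 by positivity)
    have hsumC := congrArg (fun z ↦ ((((r + 1 + 1) * (r + 1 + 2) : ℕ) : ℂ))⁻¹ • ofRatClass (ComplexPoints A.X) 2 z) hsum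
    simp only [ofRatClass_smul, map_sub, map_sum, smul_smul, Rat.cast_mul, Rat.cast_natCast, Rat.cast_ofNat] at hsumC
    rw [inv_mul_cancel₀ hCneC, one_smul] at hsumC
    -- assemble
    have hκsum : (∑ a, ∑ c, (κ * (BettiUniverse.tr hA (2 * (r + 2 + 1)) (cupProduct (show 2 + (2 * (r + 1) + 1 + 1) = 2 * (r + 1) + 1 + 1 + 1 + 1 by omega)
        x₀ (cupProduct (Nat.add_comm 1 (2 * (r + 1) + 1)) (y a) (cupProduct (show 1 + 2 * (r + 1) = 2 * (r + 1) + 1 by omega) (y c)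
          (cupPow ℚ θ (r + 1))))) : ℂ)) • ofRatClass (ComplexPoints A.X) (1 + 1) (BettiUniverse.cup A.X 1 1 (b a) (b c))) =
        κ • ∑ a, ∑ c, (BettiUniverse.tr hA (2 * (r + 2 + 1)) (cupProduct (show 2 + (2 * (r + 1) + 1 + 1) = 2 * (r + 1) + 1 + 1 + 1 + 1 by omega)
        x₀ (cupProduct (Nat.add_comm 1 (2 * (r + 1) + 1)) (y a) (cupProduct (show 1 + 2 * (r + 1) = 2 * (r + 1) + 1 by omega) (y c)
          (cupPow ℚ θ (r + 1))))) : ℂ) • ofRatClass (ComplexPoints A.X) 2 (BettiUniverse.cup A.X 1 1 (b a) (b c)) := by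
      rw [Finset.smul_sum]; refine Finset.sum_congr rfl fun a _ ↦ ?_
      rw [Finset.smul_sum]; refine Finset.sum_congr rfl fun c _ ↦ ?_
      rw [smul_smul]
    rw [hκsum, hsumC, hC, ← hΘ]
    simp only [smul_sub, smul_smul, neg_sub]
    rw [hc₀]
    congr 1
    · rw [show ofRatClass (ComplexPoints A.X) 2 x₀ = ofRatClass (ComplexPoints A.X) (1 + 1) x₀ from rfl]
      congr 1
      ring
    · congr 1
      rw [show ((r + 1 + 2 : ℕ) : ℂ) = ((r + 3 : ℕ) : ℂ) by push_cast; ring]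
      field_simp
  -- (T₁) the trace term on rational classes
  have hT₁ : ∀ x₀ : bettiCohomology A.X (1 + 1),
      cupProduct (show 2 * 1 + 0 = 1 + 1 by norm_num) (cupPow ℂ Θ 1)
        (corrAction complexOrientationFamily hA hA (show 1 + 1 + 2 * (r + 1) + 2 * 1 + 2 * 0 = 0 + 2 * (r + 2 + 1) by omega)
          (singularCohomology.one ℂ (ComplexPoints (A.X ⊗ A.X)))
          (cupProduct (rfl : 1 + 1 + 2 * (r + 1) + 2 * 1 = 1 + 1 + 2 * (r + 1) + 2 * 1)
            (cupProduct (rfl : 1 + 1 + 2 * (r + 1) = 1 + 1 + 2 * (r + 1)) (ofRatClass (ComplexPoints A.X) (1 + 1) x₀) (cupPow ℂ Θ (r + 1)))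
            (cupPow ℂ Θ 1))) =
        (κ * (BettiUniverse.tr hA (2 * (r + 2 + 1))
          (cupProduct (show 2 + 2 * (r + 1 + 1) = 2 * (r + 1) + 1 + 1 + 1 + 1 by omega) x₀ (cupPow ℚ θ (r + 1 + 1))) : ℂ)) • Θ := by
    intro x₀
    have hone : cupProduct (show 0 + 0 = 2 * 0 by rfl) (complexBetti.map (fst A.X A.X) 0 (singularCohomology.one ℂ (ComplexPoints A.X)))
        (complexBetti.map (snd A.X A.X) 0 (singularCohomology.one ℂ (ComplexPoints A.X))) = singularCohomology.one ℂ (ComplexPoints (A.X ⊗ A.X)) := by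
      rw [show complexBetti.map (fst A.X A.X) 0 (singularCohomology.one ℂ (ComplexPoints A.X)) = singularCohomology.one ℂ (ComplexPoints (A.X ⊗ A.X))
          from singularCohomology.map_one _,
        show complexBetti.map (snd A.X A.X) 0 (singularCohomology.one ℂ (ComplexPoints A.X)) = singularCohomology.one ℂ (ComplexPoints (A.X ⊗ A.X))
          from singularCohomology.map_one _]
      exact cupProduct_one _
    have hak : 1 + 1 + 2 * (r + 1) + 2 * 1 + 0 = 2 * (r + 2 + 1) := by omega
    rw [← hone, hτ (show 0 + 0 = 2 * 0 by rfl) (show 1 + 1 + 2 * (r + 1) + 2 * 1 + 2 * 0 = 0 + 2 * (r + 2 + 1) by omega) hak, mul_zero, pow_zero,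
      one_mul, map_smul, show cupProduct (show 2 * 1 + 0 = 1 + 1 by norm_num) (cupPow ℂ Θ 1) (singularCohomology.one ℂ (ComplexPoints A.X)) =
        cupPow ℂ Θ 1 from cupProduct_one _, cupPow_one_eq]
    congr 1
    -- `((x₀ ⊗ 1 ∪ Θ^{r+1}) ∪ Θ¹) ∪ 1 = (x₀ ∪ θ^{r+2}) ⊗ 1`
    rw [cupProduct_assoc (rfl : 1 + 1 + 2 * (r + 1) + 2 * 1 = 1 + 1 + 2 * (r + 1) + 2 * 1) (Nat.add_zero (2 * 1)) hak
        (show 1 + 1 + 2 * (r + 1) + 2 * 1 = 2 * (r + 2 + 1) by omega) _ Θ (singularCohomology.one ℂ (ComplexPoints A.X)),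
      cupProduct_one,
      cupProduct_assoc (rfl : 1 + 1 + 2 * (r + 1) = 1 + 1 + 2 * (r + 1)) (show 2 * (r + 1) + 2 = 2 * (r + 1 + 1) by omega)
        (show 1 + 1 + 2 * (r + 1) + 2 * 1 = 2 * (r + 2 + 1) by omega) (show 1 + 1 + 2 * (r + 1 + 1) = 2 * (r + 2 + 1) by omega)
        (ofRatClass (ComplexPoints A.X) (1 + 1) x₀) (cupPow ℂ Θ (r + 1)) Θ,
      ← cupPow_succ, hΘpow, ← ofRatClass_cupProduct, hκ]
  -- the identity on rational classes
  have hrat : ∀ x₀ : bettiCohomology A.X (1 + 1),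
      corrAction complexOrientationFamily hA hA (show 1 + 1 + 2 * (r + 1) + 2 * 2 = 2 + 2 * (r + 2 + 1) by omega) (cupPow ℂ L 2)
          (cupProduct (rfl : 1 + 1 + 2 * (r + 1) = 1 + 1 + 2 * (r + 1)) (ofRatClass (ComplexPoints A.X) (1 + 1) x₀) (cupPow ℂ Θ (r + 1))) +
        (2 / ((r + 2 : ℕ) : ℂ)) • cupProduct (show 2 * 1 + 0 = 1 + 1 by norm_num) (cupPow ℂ Θ 1)
          (corrAction complexOrientationFamily hA hA (show 1 + 1 + 2 * (r + 1) + 2 * 1 + 2 * 0 = 0 + 2 * (r + 2 + 1) by omega)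
            (singularCohomology.one ℂ (ComplexPoints (A.X ⊗ A.X)))
            (cupProduct (rfl : 1 + 1 + 2 * (r + 1) + 2 * 1 = 1 + 1 + 2 * (r + 1) + 2 * 1)
              (cupProduct (rfl : 1 + 1 + 2 * (r + 1) = 1 + 1 + 2 * (r + 1)) (ofRatClass (ComplexPoints A.X) (1 + 1) x₀) (cupPow ℂ Θ (r + 1)))
              (cupPow ℂ Θ 1))) = c₀ • ofRatClass (ComplexPoints A.X) (1 + 1) x₀ := by
    intro x₀
    rw [hT₀, hT₁, smul_smul, sub_add_eq_add_sub, sub_eq_iff_eq_add, add_right_inj]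
    congr 1
    ring
  -- extend by linearity: rational classes span `H²(A(ℂ); ℂ)`
  have hspan : x' ∈ Submodule.span ℂ (Set.range (ofRatClass (ComplexPoints A.X) (1 + 1))) := by
    have htop := span_isRationalClass_eq_top_of_isSmoothProjective_holds (r + 2 + 1) A.X hA (1 + 1)
    have hx : x' ∈ Submodule.span ℂ {c : complexBetti A.X (1 + 1) | IsRationalClass c} := by rw [htop]; exact Submodule.mem_top
    refine (Submodule.span_mono ?_) hx
    intro c hc
    exact (isRationalClass_iff_mem_range_ofRatClass c).1 hc
  induction hspan using Submodule.span_induction with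
  | mem x hx =>
    obtain ⟨x₀, rfl⟩ := hx
    exact hrat x₀
  | zero => simp
  | add u v _ _ hu hv =>
    simp only [map_add, LinearMap.add_apply, smul_add] at hu hv ⊢
    rw [← hu, ← hv]
    abel
  | smul a u _ hu =>
    simp only [map_smul, LinearMap.smul_apply] at hu ⊢
    rw [smul_comm (2 / ((r + 2 : ℕ) : ℂ)) a, ← smul_add, hu, smul_comm]

end BlockOne

end Summit.HodgeConjecture.HodgeConjecture.Ring2.AbelianAll

end
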